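import Mathlib
import HarnessLib
import Literature.MathematicalPhysics.StatisticalMechanics.RenormalisationMapFreeHtWeak
import Literature.MathematicalPhysics.StatisticalMechanics.AbkmPackageLargeSetSlack
import Literature.MathematicalPhysics.StatisticalMechanics.AbkmPackageNextHTwoKernel
import Literature.MathematicalPhysics.StatisticalMechanics.AbkmPackageLocalSlots
import Literature.MathematicalPhysics.StatisticalMechanics.RenormalisationMapBallActivityABKMQ
import Summits.HubbardSuperconductivity.HubbardSuperconductivity.Theorems.ComplexGFFStiffnessHolomorphicPackageLines

/-!
# Crux child `TwoKernelSkBound` (stmt-HubbardSuperconductivity-27414), line `banach_two_kernel`, stub `stub_f4l2ShrinkLoc` —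
# block U1 at PACKAGE level: `K_{k+1}` is `N`-free Lipschitz in the FREE intermediate Hamiltonian at the tied point

Route `route-HubbardSuperconductivity-ComplexGFFStiffness`, cruxes stmt-…-19154 `HypACumulant` / stmt-…-19155 `HypALocalTwoPoint`;
memo `Cruxes/HypACumulant/TWOKERNEL-PLAN-27414-v3.md` §2 (R1).  For every [ABKM19] package `P` with `0 < P.r` there are `N`-FREE
`L₁ ≥ 0` and `ρ₀ > 0` such that at every height, every `q` in the ball, every step `k + 1 ≤ N` and every state `(u, v)` in the
`P.r`-ball, for every relevant Hamiltonian `H̃` with `‖H̃ − H̃_q‖_{k,0} ≤ ρ₀` (`H̃_q = nextH D_q (toHam u) (mulExt v)`):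
`‖nextK(μ_q; e^{−toHam u}, e^{−H̃}, mulExt v) − S_k^{(q)}(toHam u, mulExt v)‖_{k+1}^{(A)} ≤ L₁ · ‖H̃ − H̃_q‖_{k,0}`.
This is the package discharge of the kernel-level bound `weakNormLE_nextK_freeHt_sub_nextKStep_abkm_of_stepKernelBounds` (p832225):
letters `τ' = τ_r + ρ₀` (`τ_r = 2r + v_r ≤ 3/64`, `ρ₀ = min(1/64, τ_r)`), `κ = κ_mid = 1 + e^{1/4} + 16e^{3/8}τ_r` for the large
remainders (counting conditions from `PackageData.hc3A_of_le/hc2A_of_le`), `κ₁ = κ(r)`, `ω = ω(r)`; with `b = C = r` every term of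
`Θ₁` is a package constant times `Δ_t = 16e^{3/8}‖H̃ − H̃_q‖`.  Together with the free-`H̃` holomorphy (p831625) and Theorem 6.8 on the
ball this is the uniform bound (U1) the Cauchy estimates of blocks B1–B3 consume.  All proved, no `sorry`.  Honest scope: rung route
(stiffness of a complex Gaussian gradient field via the [ABKM19] RG); nothing about superconductivity in the Hubbard model.

## References
* S. Adams, S. Buchholz, R. Kotecký, S. Müller, arXiv:1910.13564, Theorem 6.8, Lemma 9.3, Ch. 12 (12.4), Lemma 12.6 (12.53)
  [AdamsBuchholzKoteckyMuller2019].
-/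

noncomputable section

-- `Summit.<Summit>.<Problem>`: single-conjunct summit, the duplicate component is mandated (D-0017).
set_option linter.dupNamespace false

namespace Summit.HubbardSuperconductivity.HubbardSuperconductivity.Theorems.ComplexGFF

open scoped BigOperators Classical
open Finset MeasureTheory
open Literature.MathematicalPhysics.StatisticalMechanics.GradientRG
open Literature.MathematicalPhysics.StatisticalMechanics.TorusPolymer
  (IsPolymer blocks polys bprod blockOf thicken reblock boxCorner mem_polys mem_blocks numBlocks isPolymer_blockOf
    card_blocks_eq_numBlocks blocks_blockOf empty_mem_polys closure mem_blockOf_self)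
open Literature.Barriers.CriticalPhenomena.LongRangePhi4.Polymer (IsConn components)
open Literature.MathematicalPhysics.QuantumFieldTheory

variable {d : ℕ}

set_option maxHeartbeats 1600000 in
/-- **Block U1 (package level): `N`-free Lipschitz bound of `K_{k+1}` in the free intermediate Hamiltonian at the tied point**
(module docstring). [cite: AdamsBuchholzKoteckyMuller2019, Theorem 6.8 / Lemma 9.3 / Lemma 12.6 (12.53)] -/
theorem exists_weakNormLE_nextK_freeHt_sub (P : PackageData d) [Fact (0 < P.h)] [Fact (0 < P.L)] (hr0 : 0 < P.r) :
    ∃ L₁ ρ₀ : ℝ, 0 ≤ L₁ ∧ 0 < ρ₀ ∧ ∀ (N M : ℕ) [NeZero M] (Q : PackageAt P N M),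
      ∀ q : Matrix (Fin d) (Fin d) ℝ, P.InBall q → ∀ k, k + 1 ≤ N →
      ∀ (u : HamSpace ℂ d (fieldWt P.h (P.L : ℝ) d k) ((P.L : ℝ) ^ k) (P.L ^ (d * k)))
        (v : activitySpace Q.normParams k) (cv : ℝ), ‖u‖ ≤ P.r →
        activityNormLE Q.normParams k v cv → cv ≤ P.r →
      ∀ Ht : RelevantHamiltonian ℂ d,
        hamNorm (fieldWt P.h (P.L : ℝ) d k) ((P.L : ℝ) ^ k) (P.L ^ (d * k))
          (Ht - nextH (abkmStepData P.L P.R k (Q.kernels q)) (HamSpace.toHam u)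
            (mulExt ((v : activitySpace Q.normParams k) :
              Finset (Fin d → ZMod M) → ((Fin d → ZMod M) → ℝ) → ℂ))) ≤ ρ₀ →
        WeakNormLE Q.normParams (k + 1)
          (fun U φ =>
            nextK (abkmStepData P.L P.R k (Q.kernels q)).s
                (reblock (abkmStepData P.L P.R k (Q.kernels q)).s
                  ((abkmStepData P.L P.R k (Q.kernels q)).L * (abkmStepData P.L P.R k (Q.kernels q)).s))
                (stepMeasure (abkmStepData P.L P.R k (Q.kernels q)).𝒞) (expNegH (HamSpace.toHam u)) (expNegH Ht)
                (mulExt ((v : activitySpace Q.normParams k) :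
                  Finset (Fin d → ZMod M) → ((Fin d → ZMod M) → ℝ) → ℂ)) U φ -
              nextKStep (abkmStepData P.L P.R k (Q.kernels q)) (HamSpace.toHam u)
                (mulExt ((v : activitySpace Q.normParams k) :
                  Finset (Fin d → ZMod M) → ((Fin d → ZMod M) → ℝ) → ℂ)) U φ)
          (L₁ * hamNorm (fieldWt P.h (P.L : ℝ) d k) ((P.L : ℝ) ^ k) (P.L ^ (d * k))
            (Ht - nextH (abkmStepData P.L P.R k (Q.kernels q)) (HamSpace.toHam u)
              (mulExt ((v : activitySpace Q.normParams k) :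
                Finset (Fin d → ZMod M) → ((Fin d → ZMod M) → ℝ) → ℂ)))) := by
  -- letters of the package
  set C87 := pi2BoundConst d (((2 * P.R + 2 : ℕ) : ℝ) + ((d / 2 + 1 : ℕ) : ℝ)) with hC87
  have hC87_0 : 0 ≤ C87 := pi2BoundConst_nonneg d (by positivity)
  have hA0 : 0 < P.A := lt_of_lt_of_le one_pos P.hA1
  have hA𝒫0 : 0 ≤ P.A𝒫' := P.A𝒫'_nonneg
  set vr := vABKM d P.R P.A P.A𝒫' P.r with hvr
  have hvr' : vr = C87 * (P.r * P.A𝒫' * P.A⁻¹) := rfl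
  have hvr0 : 0 ≤ vr := by rw [hvr']; exact mul_nonneg hC87_0 (by positivity)
  have hvr64 : vr ≤ 1 / 64 := P.hv
  set τ := 2 * P.r + vr with hτdef
  have hτ0 : 0 < τ := by positivity
  have hτ364 : τ ≤ 3 / 64 := by rw [hτdef]; linarith only [P.hr, hvr64]
  set s := 16 * Real.exp (3 / 8) * τ with hsdef
  have hs0 : 0 < s := by positivity
  set κb := 1 + Real.exp (1 / 4) with hκbdef
  have hκb1 : 1 ≤ κb := by have := Real.exp_pos (1 / 4 : ℝ); linarith
  set κm := κb + s with hκmdef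
  have hκm0 : 0 < κm := by linarith
  have hκA : kappaABKM d P.R P.A P.A𝒫' P.r = κm + s := by
    rw [hκmdef, hκbdef, hsdef, hτdef, hvr, kappaABKM_eq_mid_add]
  set κA := kappaABKM d P.R P.A P.A𝒫' P.r with hκAdef
  have hκA0 : 0 < κA := by rw [hκA]; linarith
  have hκmA : κm ≤ κA := by rw [hκA]; linarith
  set ω := omegaABKM d P.R P.A P.A𝒫' P.r with hωdef
  have hω : ω = 8 * Real.exp (1 / 4) * τ + 2 * s := by
    rw [hωdef, hsdef, hτdef, hvr]; unfold omegaABKM; ring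
  have hω0 : 0 ≤ ω := by rw [hω]; positivity
  -- the counting conditions at the smaller letter `κ_mid`
  have hmm1 : κm * max 1 P.A𝒫' ≤ κA * max 1 P.A𝒫' :=
    mul_le_mul_of_nonneg_right hκmA (le_trans zero_le_one (le_max_left _ _))
  have hc3a := P.hc3A_of_le hκm0.le hκmA hmm1
  have hc2a := P.hc2A_of_le hκm0.le hκmA hmm1
  -- the radius and the size
  set ρ₀ : ℝ := min (1 / 64) τ with hρ₀def
  have hρ₀0 : 0 < ρ₀ := lt_min (by norm_num) hτ0
  have hρ₀τ : ρ₀ ≤ τ := min_le_right _ _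
  have hρ₀64 : ρ₀ ≤ 1 / 64 := min_le_left _ _
  have hAinv0 : 0 ≤ P.A⁻¹ := inv_nonneg.2 hA0.le
  set L₁ : ℝ := 16 * Real.exp (3 / 8) *
    (((P.L ^ d : ℕ) : ℝ) * κA ^ (P.L ^ d) *
        ((1 + 8 * C87) * (P.r * P.A𝒫' * P.A⁻¹) +
          256 * Real.exp (1 / 4) * ((P.A𝒫' + 4) * P.r ^ 2 + 2 * P.r * (C87 * (P.r * P.A𝒫' * P.A⁻¹)) +
            (C87 * (P.r * P.A𝒫' * P.A⁻¹)) ^ 2)) * P.A +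
      (3 * (ω * P.A ^ 4) + 2) + 3 * (ω * P.A ^ 4) + 3 * (ω * P.A ^ 4) +
      ((P.L ^ d : ℕ) : ℝ) * κA ^ (P.L ^ d) * P.A) with hL₁def
  have hL₁0 : 0 ≤ L₁ := by
    rw [hL₁def]
    apply_rules (maxDepth := 400) [hAinv0, hA0.le, hκA0.le, hω0, hC87_0, hA𝒫0, P.hr0, Nat.cast_nonneg, Nat.ofNat_nonneg,
      zero_le_one, Real.exp_nonneg, add_nonneg, mul_nonneg, pow_nonneg, sq_nonneg]
  refine ⟨L₁, ρ₀, hL₁0, hρ₀0, fun N M _ Q => ?_⟩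
  intro q hq k hk u v cv hu hv hcv Ht hHt
  -- sizes
  have hd2 : 2 ≤ d := le_trans (by norm_num) P.hd
  have hPA : 0 < Q.normParams.A := P.A_pos
  have hk1 : 1 ≤ P.L ^ k := Nat.one_le_pow _ _ P.hLodd.pos
  have hMt : M = Q.normParams.L ^ k * P.L ^ (N - k) := by
    show M = P.L ^ k * P.L ^ (N - k)
    rw [Q.hM, ← pow_add, Nat.add_sub_cancel' (by omega)]
  have hcv0 : 0 ≤ cv := nonneg_of_weakNormLE hPA hMt P.hLodd.pow P.hLodd.pow hv
  -- the state
  set H := HamSpace.toHam u with hHdef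
  set Kf := mulExt ((v : activitySpace Q.normParams k) :
    Finset (Fin d → ZMod M) → ((Fin d → ZMod M) → ℝ) → ℂ) with hKfdef
  have hnormu : hamNorm (fieldWt P.h (P.L : ℝ) d k) ((P.L : ℝ) ^ k) (P.L ^ (d * k)) H = ‖u‖ := by
    rw [hHdef, HamSpace.norm_def]
  have hHr : hamNorm (fieldWt P.h (P.L : ℝ) d k) ((P.L : ℝ) ^ k) (P.L ^ (d * k)) H ≤ P.r := by rw [hnormu]; exact hu
  have hKw : WeakNormLE Q.normParams k Kf cv := activitySpace.weakNormLE_mulExt v hv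
  have hKr : WeakNormLE Q.normParams k Kf P.r := hKw.mono hPA hcv
  have hKd : ∀ Y, ContDiff ℝ P.r₀ (Kf Y) := activitySpace.contDiff_mulExt v
  have hKloc : ∀ Y, IsPolymer (P.L ^ k) Y → IsConn Y → IsGaugeLocal (Q.normParams.gauge k Y) (Kf Y) :=
    fun Y hY hYc => activitySpace.isGaugeLocal_mulExt v hY hYc
  -- the step data
  have hSa := packageAt_stepKernelBounds P Q hq hk
  set Da := abkmStepData P.L P.R k (Q.kernels q) with hDa
  -- norms: `‖H̃_q‖ ≤ τ`, `‖H̃‖ ≤ τ + ρ₀ =: τ'`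
  have hL0r : (0 : ℝ) < P.L := by exact_mod_cast P.hLodd.pos
  have h𝔥 : 0 < fieldWt P.h (P.L : ℝ) d k := fieldWt_pos P.hh hL0r d k
  have hRk : (0 : ℝ) < (P.L : ℝ) ^ k := pow_pos hL0r k
  have hnn : ∀ G : RelevantHamiltonian ℂ d, 0 ≤ hamNorm (fieldWt P.h (P.L : ℝ) d k) ((P.L : ℝ) ^ k) (P.L ^ (d * k)) G :=
    fun G => hamNorm_nonneg h𝔥.le hRk.le _ _
  have hHta : hamNorm (fieldWt P.h (P.L : ℝ) d k) ((P.L : ℝ) ^ k) (P.L ^ (d * k)) (nextH Da H Kf) ≤ τ := by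
    have h := hamNorm_nextH_abkm_le_of_stepKernelBounds hd2 P.hLodd P.hL Q.hM hk (by have := P.hp; omega)
      (by have := P.hpM; have := P.hMR; omega) (by have := P.hr₀; omega) Q.hB P.hh P.hh2 P.hA1 Da hSa (x₀ := 0) rfl rfl H
      P.hr0 hKr hKd hKloc
    rw [hτdef, hvr']
    linarith [h, hHr]
  set δ := hamNorm (fieldWt P.h (P.L : ℝ) d k) ((P.L : ℝ) ^ k) (P.L ^ (d * k)) (Ht - nextH Da H Kf) with hδdef
  have hδ0 : 0 ≤ δ := hnn _
  have hδρ : δ ≤ ρ₀ := hHt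
  have hδτ : δ ≤ τ := hδρ.trans hρ₀τ
  have hHt' : hamNorm (fieldWt P.h (P.L : ℝ) d k) ((P.L : ℝ) ^ k) (P.L ^ (d * k)) Ht ≤ τ + ρ₀ := by
    have h := hamNorm_add_le h𝔥.le hRk.le (P.L ^ (d * k)) (Ht - nextH Da H Kf) (nextH Da H Kf)
    rw [sub_add_cancel] at h
    linarith [h, hHta, hδρ]
  -- the letters of the kernel-level theorem with `τ' = τ + ρ₀`
  have hexp14 : 1 ≤ Real.exp (1 / 4 : ℝ) := Real.one_le_exp (by norm_num)
  have hexp_le : Real.exp (1 / 4 : ℝ) ≤ Real.exp (3 / 8) := Real.exp_le_exp.2 (by norm_num)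
  have he38 : 0 < Real.exp (3 / 8 : ℝ) := Real.exp_pos _
  have hτa : 2 * P.r + C87 * (P.r * P.A𝒫' * P.A⁻¹) ≤ τ + ρ₀ := by rw [hτdef, hvr']; linarith [hρ₀0]
  have hτ16 : τ + ρ₀ ≤ 1 / 16 := by linarith [hτ364, hρ₀64]
  have h16δ : 16 * Real.exp (3 / 8) * δ ≤ 16 * Real.exp (3 / 8) * τ := mul_le_mul_of_nonneg_left hδτ (by positivity)
  have h16ρ : 16 * Real.exp (3 / 8) * ρ₀ ≤ 16 * Real.exp (3 / 8) * τ := mul_le_mul_of_nonneg_left hρ₀τ (by positivity)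
  have h8ρ : 8 * Real.exp (1 / 4) * ρ₀ ≤ 16 * Real.exp (3 / 8) * ρ₀ := by
    have : 8 * Real.exp (1 / 4) ≤ 16 * Real.exp (3 / 8) := by linarith [hexp_le, he38]
    exact mul_le_mul_of_nonneg_right this hρ₀0.le
  have hω1 : 8 * Real.exp (1 / 4) * (τ + ρ₀) + 16 * Real.exp (3 / 8) * δ ≤ ω := by
    rw [hω, hsdef]; linarith [h16δ, h16ρ, h8ρ]
  have h8vr : 0 ≤ 8 * Real.exp (1 / 4) * vr := by positivity
  have hω2 : 8 * Real.exp (1 / 4) * P.r + 8 * Real.exp (1 / 4) * P.r ≤ ω := by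
    rw [hω, hτdef]; linarith [h8vr, hs0]
  have hω3 : P.r ≤ ω := by
    have h1 : 8 * (2 * P.r + vr) ≤ 8 * Real.exp (1 / 4) * (2 * P.r + vr) := by
      have := mul_le_mul_of_nonneg_right hexp14 (show (0 : ℝ) ≤ 8 * (2 * P.r + vr) by positivity)
      linarith
    rw [hω, hτdef]; linarith [h1, hs0, hvr0, P.hr0]
  have hκ : 1 + Real.exp (1 / 4) + 16 * Real.exp (3 / 8) * δ ≤ κm := by
    rw [hκmdef, hκbdef, hsdef]; linarith [h16δ]
  have hκ₁ : 1 + Real.exp (1 / 4) + 16 * Real.exp (3 / 8) * δ ≤ κA := hκ.trans hκmA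
  have hκ₁' : 1 + Real.exp (1 / 4) + 16 * Real.exp (3 / 8) * (τ + ρ₀) ≤ κA := by
    rw [hκA, hκmdef, hκbdef, hsdef]; linarith [h16ρ]
  have hva : C87 * (P.r * P.A𝒫' * P.A⁻¹) ≤ 1 / 64 := by rw [← hvr']; exact hvr64
  -- the kernel-level weak bound
  have hW := weakNormLE_nextK_freeHt_sub_nextKStep_abkm_of_stepKernelBounds P.hd P.hLodd P.hL P.hR2 Q.hM hk P.hp P.hpM P.hMR P.hr₀
    Q.hB P.hδ₀ P.hδ₁ P.hh P.hh0 P.hh2 P.A𝒫'_nonneg P.hA1 Da rfl rfl hSa (x₀ := 0) rfl rfl hHr P.hr P.hr0 hKr (factorises_mulExt hk1)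
    (fun φ => mulExt_empty φ) hKd hKloc hva hτa hτ16 hHt' (ω := ω) (κ := κm) (κ₁ := κA) hω1 hω2 hω3 P.hωA hκ hκ₁ hκ₁' hc3a hc2a
  refine hW.mono hPA ?_
  -- clean the bound: `‖H − H‖ = 0`, `‖H̃_q − H̃‖ = δ`, every term carries `δ`
  have hHH : hamNorm (fieldWt P.h (P.L : ℝ) d k) ((P.L : ℝ) ^ k) (P.L ^ (d * k)) (H - H) = 0 := by
    rw [sub_self, hamNorm_zero]
  have hneg : hamNorm (fieldWt P.h (P.L : ℝ) d k) ((P.L : ℝ) ^ k) (P.L ^ (d * k)) (nextH Da H Kf - Ht) = δ := by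
    rw [hδdef, ← neg_sub, hamNorm_neg]
  rw [hHH, hneg, ← hC87]
  simp only [mul_zero, zero_mul, add_zero]
  rw [hL₁def]
  refine le_of_eq ?_
  ring

end Summit.HubbardSuperconductivity.HubbardSuperconductivity.Theorems.ComplexGFF

end
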